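import Mathlib
import Summits.Ventures.HodgeRepro0.P1LatticeIndexTwoExactSigma
import Summits.Ventures.HodgeRepro0.P1LatticeIndexOneBridge1

/-!
# P1LatticeBlockDict — D13's THEOREM A (proofs/P1-FermatLatticeClosure-v1.2.md l.4, DECLARED STATUS l.4789): ONE BLOCK SET —
THE DICTIONARY FROM THE g27 BLOCKS TO THE g28 BLOCK PREDICATE, THE GENERAL LEMMAS (pub-hodge-repro0, p1 (g29), 2026-08-30), on
lean/P1LatticeIndexOneBridge1.lean's pull-back lemma and the Hodge / Sigma files' lemmas.

Supporting artefact in the sense of ROUTE.md R-5 (finite combinatorics / exact arithmetic only; never the discharge of a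
Hodge-theoretic step; record-only).  The Theorem A artefacts state the lattice L_M in two vocabularies: p1 (g27)'s index-1
files lean/P1LatticeIndexOneA–I.lean (and the equalities H_M = L_M of lean/P1LatticeIndexOneEqA–B.lean) through the
`Block` structure — a base of level m′ ∣ M, a unit translate t, pulled back by M/m′; `Block.ok M` the page's legitimacy —,
p1 (g28)'s index-2 files (and lean/P1LatticeIndexTwoExactIndexA–B.lean) through the level-M predicate `IsBlock M m`: every
Hodge 4-multiset of ℤ/M, every Hodge 6-multiset that is the sum of two zero-sum triples, every σ_{p,i} of Aoki's full
p-standard set of level M (proofs/P1-FermatLatticeClosure-v1.2.md Lemma 1 (b) with rev-2 (g15)'s P-3: the pull-backs and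
translates of the lower levels' blocks are such multisets of level M themselves).  THIS ARTEFACT proves that claim as a
DICTIONARY, in the direction the unification needs: a legitimate g27 block's multiset at M is an `IsBlock M` multiset — so
H_M = L_M at the 88 index-1 degrees holds with the g28 block set too, and Theorem A reads in ONE vocabulary at all 118
degrees 3 ≤ M ≤ 120: with L_M := the ℤ-span of the odd vectors of all `IsBlock M` multisets, H_M = L_M at the 88 index-1
degrees (here) and [H_M : L_M] = 2 at the 30 index-2 degrees (lean/P1LatticeIndexTwoExactIndexA–B.lean), H_M the set of
odd vectors of the Hodge multisets (lean/P1LatticeHodgeImage*.lean); the M/2 coordinate of an even M as in every p1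
artefact.

THE LEMMAS, for every M: `pull` / `pull_eq` (the g27 entry map is k·((t·x) mod m′), k = M/m′); `sum_hodge_mod` (a Hodge
multiset of level m has total sum ≡ 0 mod m: its weight at 1 is |x|·m/2, |x| even); `sum_map_modEq` / `sum_pull_mod` (a
zero-sum list pulls back to a zero-sum list); `mod_add_cancel`, `isBlock_of_triples`, `exists_six`; `isBlock_six` — KIND 1: a
split Hodge 6-multiset of level m′ (a zero-sum triple through its first entry, one of the ten pairs of the g27 `split6`),
translated and pulled back, is an `IsBlock M` multiset (the triple and its complement pull back to zero-sum triples; the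
ten cases re-split the six entries, the multiset equality by commutativity); `affine_image` / `map_affine_range`
(j ↦ (u·j) mod p permutes ℤ/p); `sigma_mod`; `sigma_pull` — THE σ IDENTITY: the pull-back by k of the unit translate by t
of σ_{p,i} of level m′ IS σ_{p, k·t·i} of level M as a multiset; `isBlock_sigma_pull` — KIND 2, with
(M/p)/gcd(k·t·i mod M, M/p) = m′/p > 2; `ker_le_of_zero`; `prime_of_trial`.  Kind 0 needs only the pull-back lemma.  The
bridges: lean/P1LatticeBlockDictBridgeA.lean (A–E) / BridgeB.lean (F–I); the 88 equalities: lean/P1LatticeBlockDictEq.lean.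
NOT formalised: the converse direction of the dictionary; claim(·) for the blocks (Shioda 1981 Thm 4.3 / Lefschetz (1,1),
Aoki 1987 Thm 2-1 / Thm 1-4); anything Hodge-theoretic.
Nothing here asserts anything about whether the statement of README §1 has been proved elsewhere.
-/

namespace HodgeRepro0.P1.P1LatticeIndexTwoExact
open Matrix
/-- the pull-back by M/m′ of the unit translate by t of an entry x of level m′ (the g27 `Block.ms` entry map) -/
def pull (M m' t x : ℕ) : ℕ := (M / m') * ((t * x) % m') % M

/-- the pulled-back entry, without the outer reduction: k·((t·x) mod m′) with k = M/m′, M = k·m′ -/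
theorem pull_eq (M m' t x k : ℕ) (hk : M = k * m') (hm0 : 0 < m') : pull M m' t x = k * ((t * x) % m') := by
  unfold pull
  have hkM : M / m' = k := by rw [hk, Nat.mul_div_cancel k hm0]
  rw [hkM]
  rcases Nat.eq_zero_or_pos k with h | h
  · rw [h, Nat.zero_mul, Nat.zero_mod]
  · apply Nat.mod_eq_of_lt
    rw [hk]
    exact Nat.mul_lt_mul_of_pos_left (Nat.mod_lt _ hm0) h

/-- THE TOTAL SUM OF A HODGE MULTISET IS ≡ 0 (mod m): the weight at the unit 1 is |x|·m/2 and |x| is even -/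
theorem sum_hodge_mod (m : ℕ) (hm : 2 ≤ m) (x : List ℕ) (hH : IsHodge m (x : Multiset ℕ)) : x.sum % m = 0 := by
  obtain ⟨hev, hent, hwt⟩ := hH
  have h1 := hwt 1 (by omega) (by simp)
  rw [wt_coe, Multiset.coe_card] at h1
  have hS : S m 1 x = x.sum := by
    unfold S
    have e : x.map (fun a => (1 * a) % m) = x.map id := by
      apply List.map_congr_left
      intro a ha
      have := hent a (Multiset.mem_coe.mpr ha)
      rw [Nat.one_mul, Nat.mod_eq_of_lt this.2, id]
    rw [e, List.map_id]
  rw [hS] at h1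
  rw [Multiset.coe_card] at hev
  obtain ⟨c, hc⟩ := hev
  have h2 : (c + c) * m = 2 * (c * m) := by ring
  have : x.sum = c * m := by
    rw [hc, h2] at h1
    omega
  rw [this, Nat.mul_mod_left]

/-- sums of pointwise congruent maps are congruent -/
theorem sum_map_modEq (n : ℕ) (f g : ℕ → ℕ) (h : ∀ x, f x ≡ g x [MOD n]) :
    ∀ L : List ℕ, (L.map f).sum ≡ (L.map g).sum [MOD n]
  | [] => rfl
  | a :: l => by
    simp only [List.map_cons, List.sum_cons]
    exact Nat.ModEq.add (h a) (sum_map_modEq n f g h l)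

/-- a zero-sum list of level m′ pulls back to a zero-sum list of level M = k·m′ -/
theorem sum_pull_mod (M m' t k : ℕ) (hk : M = k * m') (hm0 : 0 < m') (T : List ℕ) (hT : T.sum % m' = 0) :
    (T.map (pull M m' t)).sum % M = 0 := by
  have e : ∀ x ∈ T, pull M m' t x = k * ((t * x) % m') := fun x _ => pull_eq M m' t x k hk hm0
  rw [List.map_congr_left e]
  have hmod : ∀ x, k * ((t * x) % m') ≡ k * (t * x) [MOD k * m'] :=
    fun x => Nat.ModEq.mul_left' k (Nat.mod_modEq (t * x) m')
  have hsum := sum_map_modEq (k * m') _ _ hmod T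
  have h2 : (T.map (fun x => k * (t * x))).sum = k * (t * T.sum) := by
    rw [List.sum_map_mul_left, List.sum_map_mul_left, List.map_id']
  unfold Nat.ModEq at hsum
  rw [hk, hsum, h2]
  exact Nat.mod_eq_zero_of_dvd (Nat.mul_dvd_mul_left k (Dvd.dvd.mul_left (Nat.dvd_of_mod_eq_zero hT) t))

/-- a sum ≡ 0 whose first part is ≡ 0 has its second part ≡ 0 -/
theorem mod_add_cancel (m x y : ℕ) (hxy : (x + y) % m = 0) (hx : x % m = 0) : y % m = 0 := by
  rw [Nat.add_mod, hx, Nat.zero_add, Nat.mod_mod] at hxy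
  exact hxy

/-- the split-6 clause of `IsBlock`, packaged -/
theorem isBlock_of_triples (M : ℕ) (m : Multiset ℕ) (T₁ T₂ : List ℕ) (h : m = ((T₁ ++ T₂ : List ℕ) : Multiset ℕ))
    (h1 : T₁.length = 3) (h2 : T₂.length = 3) (hs1 : T₁.sum % M = 0) (hs2 : T₂.sum % M = 0) (hH : IsHodge M m) :
    IsBlock M m :=
  Or.inr (Or.inl ⟨T₁, T₂, h, h1, h2, hs1, hs2, hH⟩)

/-- the pull-back entry map is the g27 `Block.ms` map -/
theorem pull_def (M m' t : ℕ) : pull M m' t = fun x => (M / m') * ((t * x) % m') % M := rfl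

/-- KIND 1: a split Hodge 6-multiset of level m′ ∣ M (a zero-sum triple through its first entry, one of the ten pairs of
the g27 `split6`), translated by a unit t and pulled back to M, is a block of the level M: the triple and its
complement (zero-sum too, the total being ≡ 0) pull back to zero-sum triples mod M -/
theorem isBlock_six (M m' t k : ℕ) (hk : M = k * m') (hm : 2 ≤ m') (hM : 0 < M) (ht : Nat.gcd t M = 1)
    (a b c d e g : ℕ) (hH : IsHodge m' (([a, b, c, d, e, g] : List ℕ) : Multiset ℕ))
    (q : ℕ × ℕ) (hq : q ∈ [(1, 2), (1, 3), (1, 4), (1, 5), (2, 3), (2, 4), (2, 5), (3, 4), (3, 5), (4, 5)])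
    (hz : ([a, b, c, d, e, g].getD 0 0 + [a, b, c, d, e, g].getD q.1 0 + [a, b, c, d, e, g].getD q.2 0) % m' = 0) :
    IsBlock M (([a, b, c, d, e, g].map (pull M m' t) : List ℕ) : Multiset ℕ) := by
  have hm0 : 0 < m' := by omega
  have hHM : IsHodge M (([a, b, c, d, e, g].map (pull M m' t) : List ℕ) : Multiset ℕ) := by
    rw [pull_def]
    exact isHodge_pullback M m' t _ hM (by rw [hk, Nat.mul_mod_left]) hm0 ht hH
  have htot := sum_hodge_mod m' hm _ hH
  simp only [List.sum_cons, List.sum_nil] at htot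
  simp only [List.mem_cons, List.not_mem_nil, or_false] at hq
  rcases hq with ⟨rfl, rfl⟩ | ⟨rfl, rfl⟩ | ⟨rfl, rfl⟩ | ⟨rfl, rfl⟩ | ⟨rfl, rfl⟩ | ⟨rfl, rfl⟩ | ⟨rfl, rfl⟩ | ⟨rfl, rfl⟩ | ⟨rfl, rfl⟩ | ⟨rfl, rfl⟩
  · -- q = (1, 2)
    simp only [List.getD_cons_zero, List.getD_cons_succ] at hz
    have hs2 : (d + e + g) % m' = 0 :=
      mod_add_cancel m' (a + b + c) (d + e + g) (by rw [show (a + b + c) + (d + e + g) = a + (b + (c + (d + (e + (g + 0))))) by ring]; exact htot) hz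
    refine isBlock_of_triples M _ ([a, b, c].map (pull M m' t)) ([d, e, g].map (pull M m' t)) ?_ rfl rfl
      (sum_pull_mod M m' t k hk hm0 _ (by simp only [List.sum_cons, List.sum_nil, Nat.add_zero, ← Nat.add_assoc]; exact hz))
      (sum_pull_mod M m' t k hk hm0 _ (by simp only [List.sum_cons, List.sum_nil, Nat.add_zero, ← Nat.add_assoc]; exact hs2)) hHM
    simp only [List.map_cons, List.map_nil, List.cons_append, List.nil_append, ← Multiset.cons_coe, ← Multiset.singleton_add, Multiset.coe_nil]
  · -- q = (1, 3)
    simp only [List.getD_cons_zero, List.getD_cons_succ] at hz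
    have hs2 : (c + e + g) % m' = 0 :=
      mod_add_cancel m' (a + b + d) (c + e + g) (by rw [show (a + b + d) + (c + e + g) = a + (b + (c + (d + (e + (g + 0))))) by ring]; exact htot) hz
    refine isBlock_of_triples M _ ([a, b, d].map (pull M m' t)) ([c, e, g].map (pull M m' t)) ?_ rfl rfl
      (sum_pull_mod M m' t k hk hm0 _ (by simp only [List.sum_cons, List.sum_nil, Nat.add_zero, ← Nat.add_assoc]; exact hz))
      (sum_pull_mod M m' t k hk hm0 _ (by simp only [List.sum_cons, List.sum_nil, Nat.add_zero, ← Nat.add_assoc]; exact hs2)) hHM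
    simp only [List.map_cons, List.map_nil, List.cons_append, List.nil_append, ← Multiset.cons_coe, ← Multiset.singleton_add, Multiset.coe_nil]
    abel
  · -- q = (1, 4)
    simp only [List.getD_cons_zero, List.getD_cons_succ] at hz
    have hs2 : (c + d + g) % m' = 0 :=
      mod_add_cancel m' (a + b + e) (c + d + g) (by rw [show (a + b + e) + (c + d + g) = a + (b + (c + (d + (e + (g + 0))))) by ring]; exact htot) hz
    refine isBlock_of_triples M _ ([a, b, e].map (pull M m' t)) ([c, d, g].map (pull M m' t)) ?_ rfl rfl
      (sum_pull_mod M m' t k hk hm0 _ (by simp only [List.sum_cons, List.sum_nil, Nat.add_zero, ← Nat.add_assoc]; exact hz))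
      (sum_pull_mod M m' t k hk hm0 _ (by simp only [List.sum_cons, List.sum_nil, Nat.add_zero, ← Nat.add_assoc]; exact hs2)) hHM
    simp only [List.map_cons, List.map_nil, List.cons_append, List.nil_append, ← Multiset.cons_coe, ← Multiset.singleton_add, Multiset.coe_nil]
    abel
  · -- q = (1, 5)
    simp only [List.getD_cons_zero, List.getD_cons_succ] at hz
    have hs2 : (c + d + e) % m' = 0 :=
      mod_add_cancel m' (a + b + g) (c + d + e) (by rw [show (a + b + g) + (c + d + e) = a + (b + (c + (d + (e + (g + 0))))) by ring]; exact htot) hz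
    refine isBlock_of_triples M _ ([a, b, g].map (pull M m' t)) ([c, d, e].map (pull M m' t)) ?_ rfl rfl
      (sum_pull_mod M m' t k hk hm0 _ (by simp only [List.sum_cons, List.sum_nil, Nat.add_zero, ← Nat.add_assoc]; exact hz))
      (sum_pull_mod M m' t k hk hm0 _ (by simp only [List.sum_cons, List.sum_nil, Nat.add_zero, ← Nat.add_assoc]; exact hs2)) hHM
    simp only [List.map_cons, List.map_nil, List.cons_append, List.nil_append, ← Multiset.cons_coe, ← Multiset.singleton_add, Multiset.coe_nil]
    abel
  · -- q = (2, 3)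
    simp only [List.getD_cons_zero, List.getD_cons_succ] at hz
    have hs2 : (b + e + g) % m' = 0 :=
      mod_add_cancel m' (a + c + d) (b + e + g) (by rw [show (a + c + d) + (b + e + g) = a + (b + (c + (d + (e + (g + 0))))) by ring]; exact htot) hz
    refine isBlock_of_triples M _ ([a, c, d].map (pull M m' t)) ([b, e, g].map (pull M m' t)) ?_ rfl rfl
      (sum_pull_mod M m' t k hk hm0 _ (by simp only [List.sum_cons, List.sum_nil, Nat.add_zero, ← Nat.add_assoc]; exact hz))
      (sum_pull_mod M m' t k hk hm0 _ (by simp only [List.sum_cons, List.sum_nil, Nat.add_zero, ← Nat.add_assoc]; exact hs2)) hHM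
    simp only [List.map_cons, List.map_nil, List.cons_append, List.nil_append, ← Multiset.cons_coe, ← Multiset.singleton_add, Multiset.coe_nil]
    abel
  · -- q = (2, 4)
    simp only [List.getD_cons_zero, List.getD_cons_succ] at hz
    have hs2 : (b + d + g) % m' = 0 :=
      mod_add_cancel m' (a + c + e) (b + d + g) (by rw [show (a + c + e) + (b + d + g) = a + (b + (c + (d + (e + (g + 0))))) by ring]; exact htot) hz
    refine isBlock_of_triples M _ ([a, c, e].map (pull M m' t)) ([b, d, g].map (pull M m' t)) ?_ rfl rfl
      (sum_pull_mod M m' t k hk hm0 _ (by simp only [List.sum_cons, List.sum_nil, Nat.add_zero, ← Nat.add_assoc]; exact hz))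
      (sum_pull_mod M m' t k hk hm0 _ (by simp only [List.sum_cons, List.sum_nil, Nat.add_zero, ← Nat.add_assoc]; exact hs2)) hHM
    simp only [List.map_cons, List.map_nil, List.cons_append, List.nil_append, ← Multiset.cons_coe, ← Multiset.singleton_add, Multiset.coe_nil]
    abel
  · -- q = (2, 5)
    simp only [List.getD_cons_zero, List.getD_cons_succ] at hz
    have hs2 : (b + d + e) % m' = 0 :=
      mod_add_cancel m' (a + c + g) (b + d + e) (by rw [show (a + c + g) + (b + d + e) = a + (b + (c + (d + (e + (g + 0))))) by ring]; exact htot) hz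
    refine isBlock_of_triples M _ ([a, c, g].map (pull M m' t)) ([b, d, e].map (pull M m' t)) ?_ rfl rfl
      (sum_pull_mod M m' t k hk hm0 _ (by simp only [List.sum_cons, List.sum_nil, Nat.add_zero, ← Nat.add_assoc]; exact hz))
      (sum_pull_mod M m' t k hk hm0 _ (by simp only [List.sum_cons, List.sum_nil, Nat.add_zero, ← Nat.add_assoc]; exact hs2)) hHM
    simp only [List.map_cons, List.map_nil, List.cons_append, List.nil_append, ← Multiset.cons_coe, ← Multiset.singleton_add, Multiset.coe_nil]
    abel
  · -- q = (3, 4)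
    simp only [List.getD_cons_zero, List.getD_cons_succ] at hz
    have hs2 : (b + c + g) % m' = 0 :=
      mod_add_cancel m' (a + d + e) (b + c + g) (by rw [show (a + d + e) + (b + c + g) = a + (b + (c + (d + (e + (g + 0))))) by ring]; exact htot) hz
    refine isBlock_of_triples M _ ([a, d, e].map (pull M m' t)) ([b, c, g].map (pull M m' t)) ?_ rfl rfl
      (sum_pull_mod M m' t k hk hm0 _ (by simp only [List.sum_cons, List.sum_nil, Nat.add_zero, ← Nat.add_assoc]; exact hz))
      (sum_pull_mod M m' t k hk hm0 _ (by simp only [List.sum_cons, List.sum_nil, Nat.add_zero, ← Nat.add_assoc]; exact hs2)) hHM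
    simp only [List.map_cons, List.map_nil, List.cons_append, List.nil_append, ← Multiset.cons_coe, ← Multiset.singleton_add, Multiset.coe_nil]
    abel
  · -- q = (3, 5)
    simp only [List.getD_cons_zero, List.getD_cons_succ] at hz
    have hs2 : (b + c + e) % m' = 0 :=
      mod_add_cancel m' (a + d + g) (b + c + e) (by rw [show (a + d + g) + (b + c + e) = a + (b + (c + (d + (e + (g + 0))))) by ring]; exact htot) hz
    refine isBlock_of_triples M _ ([a, d, g].map (pull M m' t)) ([b, c, e].map (pull M m' t)) ?_ rfl rfl
      (sum_pull_mod M m' t k hk hm0 _ (by simp only [List.sum_cons, List.sum_nil, Nat.add_zero, ← Nat.add_assoc]; exact hz))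
      (sum_pull_mod M m' t k hk hm0 _ (by simp only [List.sum_cons, List.sum_nil, Nat.add_zero, ← Nat.add_assoc]; exact hs2)) hHM
    simp only [List.map_cons, List.map_nil, List.cons_append, List.nil_append, ← Multiset.cons_coe, ← Multiset.singleton_add, Multiset.coe_nil]
    abel
  · -- q = (4, 5)
    simp only [List.getD_cons_zero, List.getD_cons_succ] at hz
    have hs2 : (b + c + d) % m' = 0 :=
      mod_add_cancel m' (a + e + g) (b + c + d) (by rw [show (a + e + g) + (b + c + d) = a + (b + (c + (d + (e + (g + 0))))) by ring]; exact htot) hz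
    refine isBlock_of_triples M _ ([a, e, g].map (pull M m' t)) ([b, c, d].map (pull M m' t)) ?_ rfl rfl
      (sum_pull_mod M m' t k hk hm0 _ (by simp only [List.sum_cons, List.sum_nil, Nat.add_zero, ← Nat.add_assoc]; exact hz))
      (sum_pull_mod M m' t k hk hm0 _ (by simp only [List.sum_cons, List.sum_nil, Nat.add_zero, ← Nat.add_assoc]; exact hs2)) hHM
    simp only [List.map_cons, List.map_nil, List.cons_append, List.nil_append, ← Multiset.cons_coe, ← Multiset.singleton_add, Multiset.coe_nil]
    abel

/-- the affine map j ↦ (u·j) mod p permutes the residues mod p when u is prime to p: its image of range p is range p -/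
theorem affine_image (p u : ℕ) (hp : 0 < p) (hu : Nat.Coprime u p) :
    (Finset.range p).image (fun j => (u * j) % p) = Finset.range p := by
  have hinj : ∀ j ∈ Finset.range p, ∀ j' ∈ Finset.range p, (u * j) % p = (u * j') % p → j = j' := by
    intro j hj j' hj' h
    rw [Finset.mem_range] at hj hj'
    have h2 : u * j ≡ u * j' [MOD p] := h
    have h3 : j ≡ j' [MOD p] := Nat.ModEq.cancel_left_of_coprime (by rw [Nat.coprime_comm] at hu; exact hu) h2
    exact Nat.ModEq.eq_of_lt_of_lt h3 hj hj'
  apply Finset.eq_of_subset_of_card_le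
  · intro x hx
    rw [Finset.mem_image] at hx
    obtain ⟨j, _, rfl⟩ := hx
    exact Finset.mem_range.mpr (Nat.mod_lt _ hp)
  · rw [Finset.card_image_of_injOn hinj]

/-- hence the multiset of the (u·j) mod p, j < p, is the multiset of the residues mod p -/
theorem map_affine_range (p u : ℕ) (hp : 0 < p) (hu : Nat.Coprime u p) :
    (Multiset.range p).map (fun j => (u * j) % p) = Multiset.range p := by
  have hinj : Set.InjOn (fun j => (u * j) % p) (Finset.range p : Set ℕ) := by
    intro j hj j' hj' h
    rw [Finset.coe_range, Set.mem_Iio] at hj hj'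
    have h2 : u * j ≡ u * j' [MOD p] := h
    have h3 : j ≡ j' [MOD p] := Nat.ModEq.cancel_left_of_coprime (by rw [Nat.coprime_comm] at hu; exact hu) h2
    exact Nat.ModEq.eq_of_lt_of_lt h3 hj hj'
  have h := Finset.image_val_of_injOn hinj
  rw [affine_image p u hp hu, Finset.range_val] at h
  exact h.symm

/-- σ_{p,i} of level M depends on i only mod M -/
theorem sigma_mod (M p i : ℕ) : sigma M p (i % M) = sigma M p i := by
  unfold sigma
  congr 1
  · apply List.map_congr_left
    intro j _
    rw [Nat.add_mod, Nat.mod_mod, ← Nat.add_mod]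
  · rw [Nat.mul_mod, Nat.mod_mod, ← Nat.mul_mod]

/-- THE σ IDENTITY: the pull-back by k of the unit translate by t of σ_{p,i} of level m′ = p·d is σ_{p, k·t·i} of level
M = k·m′, as a multiset — the residues t·(i + j·d) mod m′ are the t·i + j′·d mod m′ (j ↦ (t·j) mod p permutes ℤ/p), each
pulled back to k·(t·i + j′·d mod m′) = (k·t·i + j′·(M/p)) mod M, and the last entry −p·i pulls back to −p·k·t·i -/
theorem sigma_pull (M m' t k p i : ℕ) (hk : M = k * m') (hk0 : 0 < k) (hp0 : 0 < p) (hpd : m' % p = 0)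
    (hm0 : 0 < m') (hdi : ¬ (m' / p) ∣ i) (ht : Nat.gcd t M = 1) :
    (((sigma m' p i).map (pull M m' t) : List ℕ) : Multiset ℕ) = ((sigma M p (k * t * i) : List ℕ) : Multiset ℕ) := by
  obtain ⟨d, hd⟩ : ∃ d, m' = p * d := ⟨m' / p, (Nat.mul_div_cancel' (Nat.dvd_of_mod_eq_zero hpd)).symm⟩
  have hdp : m' / p = d := by rw [hd, Nat.mul_div_cancel_left d hp0]
  rw [hdp] at hdi
  have hd0 : 0 < d := by
    rcases Nat.eq_zero_or_pos d with h | h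
    · rw [h, Nat.mul_zero] at hd
      omega
    · exact h
  have hM0 : 0 < M := by rw [hk, hd]; positivity
  have hMp : M / p = k * d := by rw [hk, hd, ← Nat.mul_assoc, Nat.mul_comm k p, Nat.mul_assoc, Nat.mul_div_cancel_left _ hp0]
  have htm : Nat.Coprime t m' := Nat.Coprime.coprime_dvd_right (Dvd.intro_left k hk.symm) ht
  have htp : Nat.Coprime t p := Nat.Coprime.coprime_dvd_right (Dvd.intro d hd.symm) htm
  -- the entries of the first part
  have hA : ∀ j, pull M m' t ((i + j * (m' / p)) % m') = k * ((t * i + ((t * j) % p) * d) % m') := by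
    intro j
    rw [pull_eq M m' t _ k hk hm0, hdp, Nat.mul_mod, Nat.mod_mod, ← Nat.mul_mod]
    congr 1
    have e : t * (i + j * d) = t * i + ((t * j) % p) * d + m' * ((t * j) / p) := by
      have := Nat.div_add_mod (t * j) p
      calc t * (i + j * d) = t * i + (t * j) * d := by ring
        _ = t * i + (p * ((t * j) / p) + (t * j) % p) * d := by rw [this]
        _ = t * i + ((t * j) % p) * d + m' * ((t * j) / p) := by rw [hd]; ring
    rw [e, Nat.add_mul_mod_self_left]
  have hB : ∀ j, (k * t * i + j * (M / p)) % M = k * ((t * i + j * d) % m') := by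
    intro j
    rw [hMp, hk, show k * t * i + j * (k * d) = k * (t * i + j * d) by ring, Nat.mul_mod_mul_left]
  -- the first parts agree as multisets
  have hfirst : (((List.range p).map (fun j => (i + j * (m' / p)) % m')).map (pull M m' t) : Multiset ℕ) =
      (((List.range p).map (fun j => (k * t * i + j * (M / p)) % M) : List ℕ) : Multiset ℕ) := by
    rw [List.map_map]
    simp only [Function.comp_def, hA, hB]
    rw [← Multiset.map_coe, ← Multiset.map_coe, Multiset.coe_range]
    have e : (fun j => k * ((t * i + ((t * j) % p) * d) % m')) = (fun r => k * ((t * i + r * d) % m')) ∘ (fun j => (t * j) % p) := by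
      funext j
      rfl
    rw [e, ← Multiset.map_map, map_affine_range p t hp0 htp]
  -- the last entries agree
  have hr0 : 0 < (p * i) % m' := by
    rcases Nat.eq_zero_or_pos ((p * i) % m') with h | h
    · exfalso
      have h1 : p * d ∣ p * i := by rw [← hd]; exact Nat.dvd_of_mod_eq_zero h
      exact hdi (Nat.dvd_of_mul_dvd_mul_left hp0 h1)
    · exact h
  have hrlt : (p * i) % m' < m' := Nat.mod_lt _ hm0
  have hlast : pull M m' t ((m' - (p * i) % m') % m') = (M - (p * (k * t * i)) % M) % M := by
    rw [pull_eq M m' t _ k hk hm0, Nat.mod_eq_of_lt (by omega : m' - (p * i) % m' < m'),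
      mul_sub_mod m' t ((p * i) % m') htm ⟨hr0, hrlt⟩]
    have e1 : (t * ((p * i) % m')) % m' = (p * (t * i)) % m' := by
      rw [Nat.mul_mod, Nat.mod_mod, ← Nat.mul_mod]
      ring_nf
    have e2 : (p * (k * t * i)) % M = k * ((p * (t * i)) % m') := by
      rw [hk, show p * (k * t * i) = k * (p * (t * i)) by ring, Nat.mul_mod_mul_left]
    rw [e1, e2]
    have h3 : 0 < (p * (t * i)) % m' := by
      rw [← e1]
      exact mul_mod_pos m' t _ htm ⟨hr0, hrlt⟩
    have h4 : (p * (t * i)) % m' < m' := Nat.mod_lt _ hm0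
    have h5 : k * ((p * (t * i)) % m') < M := by
      rw [hk]
      exact Nat.mul_lt_mul_of_pos_left h4 hk0
    have h6 : 0 < k * ((p * (t * i)) % m') := Nat.mul_pos hk0 h3
    rw [Nat.mod_eq_of_lt (by omega : M - k * ((p * (t * i)) % m') < M), hk, ← Nat.mul_sub]
  unfold sigma
  rw [List.map_append, ← Multiset.coe_add, ← Multiset.coe_add, hfirst]
  congr 1
  rw [List.map_cons, List.map_nil, hlast]

/-- KIND 2: Aoki's σ_{p,i} of level m′ ∣ M (p an odd prime, m′/p > 2, gcd(i, m′/p) = 1), translated by a unit t and pulled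
back to M, is a block of the level M — the σ_{p, k·t·i mod M} of level M, with (M/p)/gcd(k·t·i, M/p) = m′/p > 2 -/
theorem isBlock_sigma_pull (M m' t k p i : ℕ) (hk : M = k * m') (hk0 : 0 < k) (hm0 : 0 < m') (hp : Nat.Prime p)
    (hodd : p % 2 = 1) (hpd : m' % p = 0) (hd2 : 2 < m' / p) (hgcd : Nat.gcd i (m' / p) = 1) (ht : Nat.gcd t M = 1) :
    IsBlock M (((sigma m' p i).map (pull M m' t) : List ℕ) : Multiset ℕ) := by
  have hp0 : 0 < p := hp.pos
  have hM0 : 0 < M := by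
    rw [hk]
    exact Nat.mul_pos hk0 hm0
  have hdi : ¬ (m' / p) ∣ i := by
    intro h
    have := Nat.gcd_eq_right h
    omega
  have hMp : M % p = 0 := by
    rw [hk]
    exact Nat.mod_eq_zero_of_dvd (Dvd.dvd.mul_left (Nat.dvd_of_mod_eq_zero hpd) k)
  have hMpd : M / p = k * (m' / p) := by
    rw [hk, Nat.mul_div_assoc k (Nat.dvd_of_mod_eq_zero hpd)]
  have htm : Nat.Coprime t m' := Nat.Coprime.coprime_dvd_right (Dvd.intro_left k hk.symm) ht
  have htd : Nat.Coprime t (m' / p) := Nat.Coprime.coprime_dvd_right (Nat.div_dvd_of_dvd (Nat.dvd_of_mod_eq_zero hpd)) htm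
  -- the index k·t·i mod M is nonzero
  have hi0 : 0 < (k * t * i) % M := by
    rcases Nat.eq_zero_or_pos ((k * t * i) % M) with h | h
    · exfalso
      have h1 : k * m' ∣ k * (t * i) := by rw [← hk, ← Nat.mul_assoc]; exact Nat.dvd_of_mod_eq_zero h
      have h2 : m' ∣ t * i := Nat.dvd_of_mul_dvd_mul_left hk0 h1
      have h3 : m' ∣ i := (Nat.Coprime.dvd_of_dvd_mul_left (by rw [Nat.coprime_comm]; exact htm) h2)
      exact hdi (Dvd.dvd.trans (Nat.div_dvd_of_dvd (Nat.dvd_of_mod_eq_zero hpd)) h3)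
    · exact h
  -- the gcd condition
  have hg : 2 < (M / p) / Nat.gcd ((k * t * i) % M) (M / p) := by
    have e1 : Nat.gcd ((k * t * i) % M) (M / p) = Nat.gcd (k * t * i) (M / p) := by
      apply Nat.ModEq.gcd_eq
      exact Nat.ModEq.of_dvd (Nat.div_dvd_of_dvd (Nat.dvd_of_mod_eq_zero hMp)) (Nat.mod_modEq _ _)
    have e2 : Nat.gcd (k * t * i) (M / p) = k := by
      rw [hMpd, Nat.mul_assoc, Nat.gcd_mul_left, Nat.Coprime.gcd_mul_left_cancel i htd, hgcd, Nat.mul_one]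
    rw [e1, e2, hMpd, Nat.mul_div_cancel_left _ hk0]
    exact hd2
  refine Or.inr (Or.inr ⟨p, (k * t * i) % M, hp, hodd, hMp, hi0, Nat.mod_lt _ hM0, hg, ?_⟩)
  rw [sigma_mod]
  exact sigma_pull M m' t k p i hk hk0 hp0 hpd hm0 hdi ht

/-- a list of length 6 is an explicit six-term list -/
theorem exists_six (l : List ℕ) (h : l.length = 6) : ∃ a b c d e g : ℕ, l = [a, b, c, d, e, g] := by
  rcases l with _ | ⟨a, _ | ⟨b, _ | ⟨c, _ | ⟨d, _ | ⟨e, _ | ⟨g, _ | ⟨x, rest⟩⟩⟩⟩⟩⟩⟩ <;> simp only [List.length_cons, List.length_nil] at h <;> try omega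
  exact ⟨a, b, c, d, e, g, rfl⟩

/-- H_M ≤ anything at a degree where H_M = 0 -/
theorem ker_le_of_zero {n u : ℕ} (B : Matrix (Fin u) (Fin n) ℤ) (S : Submodule ℤ (Fin n → ℤ))
    (hgen : ∀ s : Fin n → ℤ, B *ᵥ s = 0 → s = 0) : LinearMap.ker (Matrix.mulVecLin B) ≤ S := by
  intro s hs
  rw [LinearMap.mem_ker, Matrix.mulVecLin_apply] at hs
  rw [hgen s hs]
  exact Submodule.zero_mem _

/-- trial division (no r with 2 ≤ r < p divides p) implies `Nat.Prime` -/
theorem prime_of_trial (p : ℕ) (h2 : 2 ≤ p) (hall : ∀ r, r < p → r < 2 ∨ ¬ p % r = 0) : Nat.Prime p := by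
  rw [Nat.prime_def_lt]
  refine ⟨h2, fun m hm hdvd => ?_⟩
  rcases hall m hm with hlt | hmod
  · have hm0 : m ≠ 0 := by
      rintro rfl
      rw [zero_dvd_iff] at hdvd
      omega
    omega
  · exact absurd (Nat.mod_eq_zero_of_dvd hdvd) hmod

end HodgeRepro0.P1.P1LatticeIndexTwoExact
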